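import Summits.QuantumFields.BalabanUV.Beta.GAN24.PushSumNest

/-!
# `BalabanUV.Beta.GAN24.TaylorMassLam` — binder row G-an2-4 / (CONV-C), S-slot, road «S3-Taylor» (gan24-p1 `SKELETON-S3.md` v0.6 §12.7):
# generic leaf **L2** — the AVERAGING LIFT in rescaled units: multiplicity of the leg fibres, pointwise size `M^{−2(d+1)}` ∕ `M^{−(d+1)}`
# per lifted field leg pair ∕ single field leg, support radius `2(d+1)·M`, and the lifted one-step constraint Hessian `avgLift M (hessFF Lc μ y)`:
# sup `2ℓ²·M^{−2(d+1)}`, support within `2(d+1)(Lc+1)·M` of the fine image `(M·Lc)•y` of its coarse bond — constants free of the level.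

Engine of the idle leaf seat `b2b-balaban-gan24-formalise-leaf-11` (gen 14), INTENT «TAYLOR-VH1∕L2*» (cell journal l.4543); row owner gan24-p1-g4 RULINGS-5 (l.4559):
«want VH1 + L2, both in your hands; file as `GAN24/TaylorMassVH` ∕ `GAN24/TaylorMassLam`».  THIS FILE = L2 (the lift and the lifted constraint Hessian); `GAN24/TaylorMassVH` = VH1 (the pushed border increment).  NOT IN PRINT; OUR
BOOKKEEPING.  HONEST FRAMING (cell contract, verbatim): «discharging `BetaPertH` makes Bałaban's UV stability UNCONDITIONAL — a real constructive-QFT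
result; it is NOT the continuum limit and NOT the Clay problem.»  HONEST DEPENDENCY (verbatim): «continuum YM on T⁴ ⇐ BetaPertH ∧ nine spine estimates
(0/9 proved); BetaPertH ⇐ (D1) ∧ (D4) ∧ CAP+tail; G-an2-4 gates asym, D1 and NE2/3/4.»  [folklore] finite combinatorics of an4∕an2's leg sets
(`OneStepKernelFamily.LegIdx ∕ legSet ∕ legPt ∕ legW`, `InterLevelTransport.avgLift ∕ legOff`, leaf-17's `PushSumNest.mem_LegIdx_iff`) and an1's printed table facts (`AveragingHessianKernels.hessFF`,
`abs_hessKer_le`, `Near`) BY NAME; cites nothing, mints no `def … : Prop`, estimates NO resolvent leg ((N1)∕(N3) are other rows' inputs), and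
DISCHARGES NOTHING of rows V∕Λ, of «E3Shape»∕«E3SupRate», of (hS, hSall) or of BetaPertH.  NOT continuum, NOT Clay.

## What is proved ([folklore], `0 sorry`; generic `d`, every `M`, `Lc`)
§1 `legOff_inl_apply` (leg membership by `PushSumNest.mem_LegIdx_iff` BY NAME); THE FIBRE LEMMA `legIdx_eq_of_proj_of_snd_eq` (two field-leg indices whose offsets are
   congruent to the same fine point mod `M` and which share the contour parameter are EQUAL) ⇒ **`card_filter_proj_legOff_le`**: at most `M` of the `M^{d+2}` field-leg
   indices have their leg point congruent to a given fine point.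
§2 POINTWISE SIZE OF A LIFT: `abs_avgLift_le_card` (general), `card_fibre_inl_le` ∕ `card_fibre_inr_le`, **`abs_avgLift_inl_inl_le`** `|avgLift M G x w (inl α) (inl α′)| ≤ S ∕ M^{2(d+1)}`,
   `abs_avgLift_inl_inr_le` ∕ `abs_avgLift_inr_inl_le` `≤ S ∕ M^{d+1}`, from a blockwise sup bound `S` on `G` (the mm block is read at weight 1, `InterLevelTransport.avgLift_inr_inr`).
§3 SUPPORT OF A LIFT: `exists_of_avgLift_ne_zero` (a nonzero fine entry comes from a nonzero coarse entry at coarse points `X, W` with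
   `|x − M•X|₁, |w − M•W|₁ ≤ 2(d+1)M`).
§4 THE LIFTED CONSTRAINT HESSIAN (leaf L2 proper): `hessFF_ne_zero` (support in an1's `Near` boxes, field–field block only), `abs_hessFF_le` (`≤ 2ℓ²`,
   `ℓ = ell (d+1) Lc`), `l1_sub_le_of_near`, **`abs_avgLift_hessFF_le`** (`≤ 2ℓ² ∕ M^{2(d+1)}` on every block), **`avgLift_hessFF_ne_zero`** (both fine legs within
   `ℓ¹`-distance `2(d+1)(Lc+1)·M` of `(M·Lc)•y`).
§5 ℓ¹ MASS: the lattice box count `card_filter_l1_le` (`#{x ∈ S : |x − c|₁ ≤ R} ≤ (2R+1)^{d+1}`) and **`sum_abs_avgLift_hessFF_le`**: over ANY finite sets of fine points the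
   two-leg ℓ¹ mass of `avgLift M (hessFF Lc μ y)` is `≤ (4(d+1)(Lc+1)M + 1)^{2(d+1)} · 2ℓ² ∕ M^{2(d+1)} ≤ (4(d+1)(Lc+1) + 1)^{2(d+1)} · 2ℓ²` — FREE OF THE LEVEL `M`
   (sup × support volume; the units in which an1's Hessian is «a kernel of unit mass spread over its block»).
-/

noncomputable section

open Finset
open scoped BigOperators
open Literature.MathematicalPhysics.QuantumFieldTheory
open Literature.MathematicalPhysics.QuantumFieldTheory.Balaban1983to89
open Literature.MathematicalPhysics.QuantumFieldTheory.Balaban1983to89.Beta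
open Literature.Probability.LatticeModels (Torus.proj Torus.proj_apply)
open LatticeForm (quo)
open B12Sec2to5 (l1 l1_nonneg)
open ExpKernelCalculus (MKer l1_natSmul l1_sub_triangle)
open OneStepResolventKernel (Fib eq_zsmul_quo_of_proj)
open OneStepKernelFamily (LegIdx legSet legPt legW legW_nonneg sum_legW l1_legPt_sub_le)
open InterLevelTransport (avgLift legOff legPt_eq_add_legOff)
open Summit.QuantumFields.BalabanUV.Beta.GAN24.PushSumNest (mem_LegIdx_iff)
open AveragingHessianKernels (hessFF hessKer Near ell near_self l1_le_of_near hessKer_eq_zero_left hessKer_eq_zero_right abs_hessKer_le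
  hessFF_inl_inl hessFF_inl_inr hessFF_inr)

namespace Summit.QuantumFields.BalabanUV.Beta.GAN24.TaylorMassLam

variable {d : ℕ}

/-! ## §1 Leg indices: membership, offsets, and the fibre lemma -/

/-- [folklore] The offset of a field-leg index: `r + s e_κ`. -/
theorem legOff_inl_apply (M : ℕ) (κ : Fin (d + 1)) (i : (Fin (d + 1) → ℕ) × ℕ) (j : Fin (d + 1)) :
    legOff M (Sum.inl κ : Fib d) i j = (i.1 j : ℤ) + if j = κ then (i.2 : ℤ) else 0 := by
  simp only [legOff, legPt, smul_zero, Pi.add_apply, Pi.zero_apply, zero_add]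

/-- [folklore] Residues of naturals below `M` determine them. -/
theorem nat_eq_of_zmod_eq {M a b : ℕ} (ha : a < M) (hb : b < M) (h : ((a : ℤ) : ZMod M) = ((b : ℤ) : ZMod M)) : a = b := by
  rw [Int.cast_natCast, Int.cast_natCast] at h
  have h2 := (ZMod.natCast_eq_natCast_iff' a b M).1 h
  rwa [Nat.mod_eq_of_lt ha, Nat.mod_eq_of_lt hb] at h2

/-- [folklore] **THE FIBRE LEMMA**: two field-leg indices whose offsets are congruent to the same fine point mod `M` and which share the
contour parameter coincide (block coordinates are residues below `M`). -/
theorem legIdx_eq_of_proj_of_snd_eq {M : ℕ} (κ : Fin (d + 1)) (x : Fin (d + 1) → ℤ) {i i' : (Fin (d + 1) → ℕ) × ℕ}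
    (hi : i ∈ LegIdx d M) (hi' : i' ∈ LegIdx d M) (h : Torus.proj M (x - legOff M (Sum.inl κ : Fib d) i) = 0)
    (h' : Torus.proj M (x - legOff M (Sum.inl κ : Fib d) i') = 0) (h2 : i.2 = i'.2) : i = i' := by
  rw [mem_LegIdx_iff] at hi hi'
  refine Prod.ext (funext fun j => ?_) h2
  have hj := congrFun h j
  have hj' := congrFun h' j
  rw [Torus.proj_apply, Pi.zero_apply, Pi.sub_apply, legOff_inl_apply, Int.cast_sub, sub_eq_zero] at hj hj'
  rw [hj, h2] at hj'
  rw [Int.cast_add, Int.cast_add, add_left_inj] at hj'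
  exact nat_eq_of_zmod_eq (hi.1 j) (hi'.1 j) hj'

/-- [folklore] **AT MOST `M` FIELD-LEG INDICES ARE CONGRUENT TO A GIVEN FINE POINT** (they inject into `range M` by the contour parameter). -/
theorem card_filter_proj_legOff_le (M : ℕ) (κ : Fin (d + 1)) (x : Fin (d + 1) → ℤ) :
    ((LegIdx d M).filter fun i => Torus.proj M (x - legOff M (Sum.inl κ : Fib d) i) = 0).card ≤ M := by
  calc ((LegIdx d M).filter fun i => Torus.proj M (x - legOff M (Sum.inl κ : Fib d) i) = 0).card ≤ (Finset.range M).card := by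
        refine Finset.card_le_card_of_injOn Prod.snd (fun i hi => ?_) (fun i hi i' hi' h2 => ?_)
        · rw [Finset.coe_filter] at hi
          exact Finset.mem_coe.2 (Finset.mem_range.2 (mem_LegIdx_iff.1 hi.1).2)
        · rw [Finset.coe_filter] at hi hi'
          exact legIdx_eq_of_proj_of_snd_eq κ x hi.1 hi'.1 hi.2 hi'.2 h2
    _ = M := Finset.card_range M

/-! ## §2 Pointwise size of an averaging lift -/

section Size

variable (M : ℕ) (G : MKer (d + 1) (Fib d))

/-- [folklore] General pointwise bound: `|avgLift M G x w a b| ≤ (#fibre of x)·(#fibre of w)·legW a·legW b·S` from a blockwise sup bound `S`. -/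
theorem abs_avgLift_le_card (a b : Fib d) {S : ℝ} (hS : ∀ X W, |G X W a b| ≤ S) (x w : Fin (d + 1) → ℤ) :
    |avgLift M G x w a b| ≤
      ((legSet d M a).filter fun i => Torus.proj M (x - legOff M a i) = 0).card *
        ((legSet d M b).filter fun i' => Torus.proj M (w - legOff M b i') = 0).card * (legW d M a * legW d M b * S) := by
  have hS0 : 0 ≤ S := (abs_nonneg _).trans (hS 0 0)
  have hw : 0 ≤ legW d M a * legW d M b := mul_nonneg (legW_nonneg M a) (legW_nonneg M b)
  unfold avgLift
  refine (Finset.abs_sum_le_sum_abs _ _).trans ?_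
  refine (Finset.sum_le_sum fun i _ => Finset.abs_sum_le_sum_abs _ _).trans ?_
  have hterm : ∀ i i', |legW d M a * legW d M b *
      (if Torus.proj M (x - legOff M a i) = 0 ∧ Torus.proj M (w - legOff M b i') = 0 then
        G (quo M (x - legOff M a i)) (quo M (w - legOff M b i')) a b else 0)| ≤
      (if Torus.proj M (x - legOff M a i) = 0 then (1 : ℝ) else 0) * (if Torus.proj M (w - legOff M b i') = 0 then (1 : ℝ) else 0) *
        (legW d M a * legW d M b * S) := by
    intro i i'
    by_cases h1 : Torus.proj M (x - legOff M a i) = 0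
    · by_cases h2 : Torus.proj M (w - legOff M b i') = 0
      · rw [if_pos ⟨h1, h2⟩, if_pos h1, if_pos h2, one_mul, one_mul, abs_mul, abs_of_nonneg hw]
        exact mul_le_mul_of_nonneg_left (hS _ _) hw
      · rw [if_neg (fun h => h2 h.2), if_neg h2, mul_zero, abs_zero, mul_zero, zero_mul]
    · rw [if_neg (fun h => h1 h.1), if_neg h1, mul_zero, abs_zero, zero_mul, zero_mul]
  refine (Finset.sum_le_sum fun i _ => Finset.sum_le_sum fun i' _ => hterm i i').trans (le_of_eq ?_)
  simp_rw [← Finset.sum_mul]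
  rw [← Finset.sum_mul_sum, Finset.sum_boole, Finset.sum_boole]

/-- [folklore] The fibre of a fine point in a FIELD leg set has at most `M` elements. -/
theorem card_fibre_inl_le (κ : Fin (d + 1)) (x : Fin (d + 1) → ℤ) :
    (((legSet d M (Sum.inl κ : Fib d)).filter fun i => Torus.proj M (x - legOff M (Sum.inl κ : Fib d) i) = 0).card : ℝ) ≤ M := by
  exact_mod_cast card_filter_proj_legOff_le M κ x

/-- [folklore] The fibre of a fine point in a MULTIPLIER leg set has at most `1` element. -/
theorem card_fibre_inr_le (μ : Fin (d + 1)) (x : Fin (d + 1) → ℤ) :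
    (((legSet d M (Sum.inr μ : Fib d)).filter fun i => Torus.proj M (x - legOff M (Sum.inr μ : Fib d) i) = 0).card : ℝ) ≤ 1 := by
  have : ((legSet d M (Sum.inr μ : Fib d)).filter fun i => Torus.proj M (x - legOff M (Sum.inr μ : Fib d) i) = 0).card ≤ 1 :=
    (Finset.card_filter_le _ _).trans (by simp [legSet])
  exact_mod_cast this

/-- [folklore] **FIELD–FIELD BLOCK**: `|avgLift M G x w (inl α) (inl α′)| ≤ S ∕ M^{2(d+1)}` — two field legs, each fibre of size `≤ M`, each weight `M^{−(d+2)}`. -/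
theorem abs_avgLift_inl_inl_le [NeZero M] (α α' : Fin (d + 1)) {S : ℝ} (hS : ∀ X W, |G X W (Sum.inl α) (Sum.inl α')| ≤ S)
    (x w : Fin (d + 1) → ℤ) : |avgLift M G x w (Sum.inl α) (Sum.inl α')| ≤ S / (M : ℝ) ^ (2 * (d + 1)) := by
  have hS0 : 0 ≤ S := (abs_nonneg _).trans (hS 0 0)
  have hM : (0 : ℝ) < M := by exact_mod_cast Nat.pos_of_ne_zero (NeZero.ne M)
  have h := abs_avgLift_le_card M G (Sum.inl α) (Sum.inl α') hS x w
  have c1 := card_fibre_inl_le M α x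
  have c2 := card_fibre_inl_le M α' w
  have hw : legW d M (Sum.inl α : Fib d) * legW d M (Sum.inl α' : Fib d) * S = S / ((M : ℝ) ^ (d + 2) * (M : ℝ) ^ (d + 2)) := by
    simp only [legW]; field_simp
  rw [hw] at h
  refine h.trans ?_
  have key : (M : ℝ) * M * (S / ((M : ℝ) ^ (d + 2) * (M : ℝ) ^ (d + 2))) = S / (M : ℝ) ^ (2 * (d + 1)) := by
    field_simp; ring
  rw [← key]
  have hq : 0 ≤ S / ((M : ℝ) ^ (d + 2) * (M : ℝ) ^ (d + 2)) := by positivity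
  exact mul_le_mul_of_nonneg_right (mul_le_mul c1 c2 (Nat.cast_nonneg _) hM.le) hq

/-- [folklore] **FIELD–MULTIPLIER BLOCK**: `|avgLift M G x w (inl α) (inr μ)| ≤ S ∕ M^{d+1}`. -/
theorem abs_avgLift_inl_inr_le [NeZero M] (α μ : Fin (d + 1)) {S : ℝ} (hS : ∀ X W, |G X W (Sum.inl α) (Sum.inr μ)| ≤ S)
    (x w : Fin (d + 1) → ℤ) : |avgLift M G x w (Sum.inl α) (Sum.inr μ)| ≤ S / (M : ℝ) ^ (d + 1) := by
  have hS0 : 0 ≤ S := (abs_nonneg _).trans (hS 0 0)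
  have hM : (0 : ℝ) < M := by exact_mod_cast Nat.pos_of_ne_zero (NeZero.ne M)
  have h := abs_avgLift_le_card M G (Sum.inl α) (Sum.inr μ) hS x w
  have c1 := card_fibre_inl_le M α x
  have c2 := card_fibre_inr_le M μ w
  have hw : legW d M (Sum.inl α : Fib d) * legW d M (Sum.inr μ : Fib d) * S = S / (M : ℝ) ^ (d + 2) := by
    simp only [legW]; field_simp
  rw [hw] at h
  refine h.trans ?_
  have key : (M : ℝ) * 1 * (S / (M : ℝ) ^ (d + 2)) = S / (M : ℝ) ^ (d + 1) := by field_simp; ring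
  rw [← key]
  have hq : 0 ≤ S / (M : ℝ) ^ (d + 2) := by positivity
  exact mul_le_mul_of_nonneg_right (mul_le_mul c1 c2 (Nat.cast_nonneg _) hM.le) hq

/-- [folklore] **MULTIPLIER–FIELD BLOCK**: `|avgLift M G x w (inr μ) (inl α)| ≤ S ∕ M^{d+1}`. -/
theorem abs_avgLift_inr_inl_le [NeZero M] (μ α : Fin (d + 1)) {S : ℝ} (hS : ∀ X W, |G X W (Sum.inr μ) (Sum.inl α)| ≤ S)
    (x w : Fin (d + 1) → ℤ) : |avgLift M G x w (Sum.inr μ) (Sum.inl α)| ≤ S / (M : ℝ) ^ (d + 1) := by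
  have hS0 : 0 ≤ S := (abs_nonneg _).trans (hS 0 0)
  have hM : (0 : ℝ) < M := by exact_mod_cast Nat.pos_of_ne_zero (NeZero.ne M)
  have h := abs_avgLift_le_card M G (Sum.inr μ) (Sum.inl α) hS x w
  have c1 := card_fibre_inr_le M μ x
  have c2 := card_fibre_inl_le M α w
  have hw : legW d M (Sum.inr μ : Fib d) * legW d M (Sum.inl α : Fib d) * S = S / (M : ℝ) ^ (d + 2) := by
    simp only [legW]; field_simp
  rw [hw] at h
  refine h.trans ?_
  have key : (1 : ℝ) * M * (S / (M : ℝ) ^ (d + 2)) = S / (M : ℝ) ^ (d + 1) := by field_simp; ring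
  rw [← key]
  have hq : 0 ≤ S / (M : ℝ) ^ (d + 2) := by positivity
  exact mul_le_mul_of_nonneg_right (mul_le_mul c1 c2 (Nat.cast_nonneg _) zero_le_one) hq

end Size

/-! ## §3 Support of an averaging lift -/

/-- [folklore] The offset of any leg index in its leg set has `ℓ¹`-size at most `2(d+1)M`. -/
theorem l1_legOff_le (M : ℕ) (a : Fib d) {i : (Fin (d + 1) → ℕ) × ℕ} (hi : i ∈ legSet d M a) :
    l1 (legOff M a i) ≤ 2 * (d + 1) * M := by
  have h := l1_legPt_sub_le M a 0 hi
  simpa only [legOff, smul_zero, sub_zero] using h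

/-- [folklore] **A NONZERO LIFTED ENTRY COMES FROM A NONZERO COARSE ENTRY NEARBY** (`|x − M•X|₁, |w − M•W|₁ ≤ 2(d+1)M`). -/
theorem exists_of_avgLift_ne_zero (M : ℕ) [NeZero M] (G : MKer (d + 1) (Fib d)) {x w : Fin (d + 1) → ℤ} {a b : Fib d}
    (h : avgLift M G x w a b ≠ 0) :
    ∃ X W : Fin (d + 1) → ℤ, G X W a b ≠ 0 ∧ l1 (x - (M : ℤ) • X) ≤ 2 * (d + 1) * M ∧ l1 (w - (M : ℤ) • W) ≤ 2 * (d + 1) * M := by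
  unfold avgLift at h
  obtain ⟨i, hi, h1⟩ := Finset.exists_ne_zero_of_sum_ne_zero h
  obtain ⟨i', hi', h2⟩ := Finset.exists_ne_zero_of_sum_ne_zero h1
  have hc : Torus.proj M (x - legOff M a i) = 0 ∧ Torus.proj M (w - legOff M b i') = 0 := by
    by_contra hc; exact h2 (by rw [if_neg hc, mul_zero])
  rw [if_pos hc] at h2
  refine ⟨quo M (x - legOff M a i), quo M (w - legOff M b i'), fun h0 => h2 (by rw [h0, mul_zero]), ?_, ?_⟩
  · have e := eq_zsmul_quo_of_proj (N := M) hc.1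
    have e' : x - (M : ℤ) • quo M (x - legOff M a i) = legOff M a i := by rw [← e]; abel
    rw [e']
    exact l1_legOff_le M a hi
  · have e := eq_zsmul_quo_of_proj (N := M) hc.2
    have e' : w - (M : ℤ) • quo M (w - legOff M b i') = legOff M b i' := by rw [← e]; abel
    rw [e']
    exact l1_legOff_le M b hi'

/-! ## §4 The lifted one-step constraint Hessian (leaf L2) -/

section Hessian

variable {Lc : ℕ}

/-- [folklore] SUPPORT OF an1's CONSTRAINT HESSIAN: a nonzero entry of `hessFF Lc μ y` is a field–field entry with both sites in the `Near` box of the bond. -/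
theorem hessFF_ne_zero {μ : Fin (d + 1)} {y X W : Fin (d + 1) → ℤ} {a b : Fib d} (h : hessFF Lc μ y X W a b ≠ 0) :
    (∃ α α' : Fin (d + 1), a = Sum.inl α ∧ b = Sum.inl α') ∧ Near Lc y X ∧ Near Lc y W := by
  rcases a with α | ν
  · rcases b with α' | ν'
    · rw [hessFF_inl_inl] at h
      refine ⟨⟨α, α', rfl, rfl⟩, ?_, ?_⟩
      · by_contra hX; exact h (hessKer_eq_zero_left hX _)
      · by_contra hW; exact h (hessKer_eq_zero_right _ hW)
    · exact absurd (hessFF_inl_inr Lc μ y X W α ν') h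
  · exact absurd (hessFF_inr Lc μ y X W ν b) h

/-- [folklore] an1's printed entry bound carried to the packed kernel: `|hessFF Lc μ y X W a b| ≤ 2ℓ²` on every block (`ℓ = ell (d+1) Lc`). -/
theorem abs_hessFF_le (hL : 1 ≤ Lc) (μ : Fin (d + 1)) (y X W : Fin (d + 1) → ℤ) (a b : Fib d) :
    |hessFF Lc μ y X W a b| ≤ 2 * (ell (d + 1) Lc : ℝ) ^ 2 := by
  have h0 : (0 : ℝ) ≤ 2 * (ell (d + 1) Lc : ℝ) ^ 2 := by positivity
  rcases a with α | ν
  · rcases b with α' | ν'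
    · rw [hessFF_inl_inl]; exact abs_hessKer_le hL μ y _ _
    · rw [hessFF_inl_inr, abs_zero]; exact h0
  · rw [hessFF_inr, abs_zero]; exact h0

/-- [folklore] A point of the `Near` box of the bond `y` is within `ℓ¹`-distance `2(d+1)Lc` of the box's base point `Lc•y`. -/
theorem l1_sub_le_of_near (hL : 1 ≤ Lc) {y X : Fin (d + 1) → ℤ} (hX : Near Lc y X) : l1 (X - (Lc : ℤ) • y) ≤ 2 * ((d : ℝ) + 1) * Lc :=
  l1_le_of_near hX (near_self hL y)

/-- [folklore] **L2, SIZE — THE LIFTED CONSTRAINT HESSIAN IS `O(M^{−2(d+1)})` POINTWISE**: `|avgLift M (hessFF Lc μ y) x w a b| ≤ 2ℓ² ∕ M^{2(d+1)}` on every block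
(the kernel lives on the field–field block; `M^{−(d+2)}` per lifted field leg times the fibre multiplicity `M`). -/
theorem abs_avgLift_hessFF_le (M : ℕ) [NeZero M] (hL : 1 ≤ Lc) (μ : Fin (d + 1)) (y x w : Fin (d + 1) → ℤ) (a b : Fib d) :
    |avgLift M (hessFF Lc μ y) x w a b| ≤ 2 * (ell (d + 1) Lc : ℝ) ^ 2 / (M : ℝ) ^ (2 * (d + 1)) := by
  have h0 : (0 : ℝ) ≤ 2 * (ell (d + 1) Lc : ℝ) ^ 2 / (M : ℝ) ^ (2 * (d + 1)) := by positivity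
  rcases a with α | ν
  · rcases b with α' | ν'
    · exact abs_avgLift_inl_inl_le M (hessFF Lc μ y) α α' (fun X W => abs_hessFF_le hL μ y X W _ _) x w
    · -- the (inl, inr) block of `hessFF` vanishes identically, hence so does its lift
      have hz : avgLift M (hessFF Lc μ y) x w (Sum.inl α) (Sum.inr ν') = 0 := by
        by_contra hne
        obtain ⟨X, W, hG, -, -⟩ := exists_of_avgLift_ne_zero M (hessFF Lc μ y) hne
        exact hG (hessFF_inl_inr Lc μ y X W α ν')
      rw [hz, abs_zero]; exact h0
  · have hz : avgLift M (hessFF Lc μ y) x w (Sum.inr ν) b = 0 := by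
      by_contra hne
      obtain ⟨X, W, hG, -, -⟩ := exists_of_avgLift_ne_zero M (hessFF Lc μ y) hne
      exact hG (hessFF_inr Lc μ y X W ν b)
    rw [hz, abs_zero]; exact h0

/-- [folklore] **L2, SUPPORT**: a nonzero entry of `avgLift M (hessFF Lc μ y)` has both fine legs within `ℓ¹`-distance `2(d+1)(Lc+1)·M` of the
fine image `(M·Lc)•y` of its coarse bond — `O(1)` in the units of any member `N ≥ M·Lc`. -/
theorem avgLift_hessFF_ne_zero (M : ℕ) [NeZero M] (hL : 1 ≤ Lc) {μ : Fin (d + 1)} {y x w : Fin (d + 1) → ℤ} {a b : Fib d}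
    (h : avgLift M (hessFF Lc μ y) x w a b ≠ 0) :
    l1 (x - ((M * Lc : ℕ) : ℤ) • y) ≤ 2 * ((d : ℝ) + 1) * (Lc + 1) * M ∧ l1 (w - ((M * Lc : ℕ) : ℤ) • y) ≤ 2 * ((d : ℝ) + 1) * (Lc + 1) * M := by
  obtain ⟨X, W, hG, hx, hw⟩ := exists_of_avgLift_ne_zero M (hessFF Lc μ y) h
  obtain ⟨-, hX, hW⟩ := hessFF_ne_zero hG
  have hM : (0 : ℝ) ≤ M := Nat.cast_nonneg M
  have key : ∀ {v V : Fin (d + 1) → ℤ}, l1 (v - (M : ℤ) • V) ≤ 2 * (d + 1) * M → Near Lc y V →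
      l1 (v - ((M * Lc : ℕ) : ℤ) • y) ≤ 2 * ((d : ℝ) + 1) * (Lc + 1) * M := by
    intro v V hv hV
    have h1 : l1 ((M : ℤ) • V - ((M * Lc : ℕ) : ℤ) • y) = (M : ℝ) * l1 (V - (Lc : ℤ) • y) := by
      rw [← l1_natSmul, smul_sub, smul_smul]; push_cast; rfl
    have h2 := l1_sub_le_of_near hL hV
    have tri := l1_sub_triangle v ((M : ℤ) • V) (((M * Lc : ℕ) : ℤ) • y)
    rw [h1] at tri
    have h3 : (M : ℝ) * l1 (V - (Lc : ℤ) • y) ≤ (M : ℝ) * (2 * ((d : ℝ) + 1) * Lc) := mul_le_mul_of_nonneg_left h2 hM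
    have h4 : (2 : ℝ) * (d + 1) * M + M * (2 * ((d : ℝ) + 1) * Lc) = 2 * ((d : ℝ) + 1) * (Lc + 1) * M := by ring
    linarith
  exact ⟨key hx hX, key hw hW⟩

end Hessian

/-! ## §5 ℓ¹ mass: box counts and the level-free mass of the lifted Hessian -/

section Mass

variable {Lc : ℕ}

/-- [folklore] **LATTICE BOX COUNT**: at most `(2R+1)^{d+1}` points of any finite set lie within `ℓ¹`-distance `R` of a given centre. -/
theorem card_filter_l1_le (S : Finset (Fin (d + 1) → ℤ)) (c : Fin (d + 1) → ℤ) (R : ℕ) :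
    (S.filter fun x => l1 (x - c) ≤ R).card ≤ (2 * R + 1) ^ (d + 1) := by
  classical
  have hsub : (S.filter fun x => l1 (x - c) ≤ R) ⊆ Fintype.piFinset fun j => Finset.Icc (c j - R) (c j + R) := by
    intro x hx
    rw [Finset.mem_filter] at hx
    rw [Fintype.mem_piFinset]
    intro j
    rw [Finset.mem_Icc]
    have h1 : |(((x - c) j : ℤ) : ℝ)| ≤ R := by
      refine le_trans ?_ hx.2
      unfold B12Sec2to5.l1
      exact Finset.single_le_sum (f := fun i => |(((x - c) i : ℤ) : ℝ)|) (fun i _ => abs_nonneg _) (Finset.mem_univ j)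
    have h2 : |x j - c j| ≤ (R : ℤ) := by
      have : (|((x j - c j : ℤ) : ℝ)|) ≤ R := by simpa [Pi.sub_apply] using h1
      rw [← Int.cast_abs] at this
      exact_mod_cast this
    rw [abs_le] at h2
    constructor <;> omega
  refine (Finset.card_le_card hsub).trans ?_
  rw [Fintype.card_piFinset]
  have hc : ∀ i, (Finset.Icc (c i - R) (c i + R)).card = 2 * R + 1 := fun i => by rw [Int.card_Icc]; omega
  simp only [hc, Finset.prod_const, Finset.card_univ, Fintype.card_fin, le_refl]

/-- [folklore] A double sum of `|F|` with `F` supported in an `ℓ¹`-ball of radius `R` and bounded by `B` is `≤ (2R+1)^{2(d+1)}·B`. -/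
theorem sum_abs_le_of_support {S T : Finset (Fin (d + 1) → ℤ)} (F : (Fin (d + 1) → ℤ) → (Fin (d + 1) → ℤ) → ℝ) (c : Fin (d + 1) → ℤ)
    (R : ℕ) {B : ℝ} (hB : 0 ≤ B) (hsupp : ∀ x w, F x w ≠ 0 → l1 (x - c) ≤ R ∧ l1 (w - c) ≤ R) (hbd : ∀ x w, |F x w| ≤ B) :
    ∑ x ∈ S, ∑ w ∈ T, |F x w| ≤ ((2 * R + 1) ^ (d + 1) : ℕ) * ((2 * R + 1) ^ (d + 1) : ℕ) * B := by
  classical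
  set S' := S.filter fun x => l1 (x - c) ≤ R with hS'
  set T' := T.filter fun w => l1 (w - c) ≤ R with hT'
  have hS'sub : S' ⊆ S := Finset.filter_subset _ _
  have hT'sub : T' ⊆ T := Finset.filter_subset _ _
  have hA : ∀ x ∈ S, ∑ w ∈ T, |F x w| = ∑ w ∈ T', |F x w| := fun x hx => by
    refine (Finset.sum_subset hT'sub fun w hw hw' => ?_).symm
    rw [abs_eq_zero]
    by_contra hne
    exact hw' (Finset.mem_filter.2 ⟨hw, (hsupp x w hne).2⟩)
  have hB' : ∑ x ∈ S, ∑ w ∈ T', |F x w| = ∑ x ∈ S', ∑ w ∈ T', |F x w| := by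
    refine (Finset.sum_subset hS'sub fun x hx hx' => ?_).symm
    refine Finset.sum_eq_zero fun w hw => ?_
    rw [abs_eq_zero]
    by_contra hne
    exact hx' (Finset.mem_filter.2 ⟨hx, (hsupp x w hne).1⟩)
  rw [Finset.sum_congr rfl hA, hB']
  calc ∑ x ∈ S', ∑ w ∈ T', |F x w| ≤ ∑ x ∈ S', ∑ w ∈ T', B := Finset.sum_le_sum fun x _ => Finset.sum_le_sum fun w _ => hbd x w
    _ = (S'.card : ℝ) * ((T'.card : ℝ) * B) := by rw [Finset.sum_const, Finset.sum_const, nsmul_eq_mul, nsmul_eq_mul]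
    _ ≤ ((2 * R + 1) ^ (d + 1) : ℕ) * (((2 * R + 1) ^ (d + 1) : ℕ) * B) := by
        have h1 : (S'.card : ℝ) ≤ ((2 * R + 1) ^ (d + 1) : ℕ) := by exact_mod_cast card_filter_l1_le S c R
        have h2 : (T'.card : ℝ) ≤ ((2 * R + 1) ^ (d + 1) : ℕ) := by exact_mod_cast card_filter_l1_le T c R
        exact mul_le_mul h1 (mul_le_mul_of_nonneg_right h2 hB) (by positivity) (by positivity)
    _ = _ := by ring

/-- [folklore] **L2, MASS**: over any finite sets of fine points `Σ_x Σ_w |avgLift M (hessFF Lc μ y) x w a b| ≤ (2R+1)^{2(d+1)} · 2ℓ² ∕ M^{2(d+1)}`,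
`R = 2(d+1)(Lc+1)M`; with `massLam_le` this is `≤ (4(d+1)(Lc+1)+1)^{2(d+1)} · 2ℓ²`, a constant of `(d, Lc)` alone. -/
theorem sum_abs_avgLift_hessFF_le (M : ℕ) [NeZero M] (hL : 1 ≤ Lc) (μ : Fin (d + 1)) (y : Fin (d + 1) → ℤ) (a b : Fib d)
    (S T : Finset (Fin (d + 1) → ℤ)) :
    ∑ x ∈ S, ∑ w ∈ T, |avgLift M (hessFF Lc μ y) x w a b| ≤
      ((2 * (2 * (d + 1) * (Lc + 1) * M) + 1) ^ (d + 1) : ℕ) * ((2 * (2 * (d + 1) * (Lc + 1) * M) + 1) ^ (d + 1) : ℕ) *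
        (2 * (ell (d + 1) Lc : ℝ) ^ 2 / (M : ℝ) ^ (2 * (d + 1))) := by
  refine sum_abs_le_of_support (fun x w => avgLift M (hessFF Lc μ y) x w a b) (((M * Lc : ℕ) : ℤ) • y) (2 * (d + 1) * (Lc + 1) * M)
    (by positivity) (fun x w hne => ?_) (fun x w => abs_avgLift_hessFF_le M hL μ y x w a b)
  have h := avgLift_hessFF_ne_zero M hL hne
  have e : ((2 * (d + 1) * (Lc + 1) * M : ℕ) : ℝ) = 2 * ((d : ℝ) + 1) * (Lc + 1) * M := by push_cast; ring
  rw [e]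
  exact h

/-- [folklore] The level-free form of the mass constant: `(2R+1)^{2(d+1)} · 2ℓ² ∕ M^{2(d+1)} ≤ (4(d+1)(Lc+1)+1)^{2(d+1)} · 2ℓ²` for `R = 2(d+1)(Lc+1)M`, `M ≥ 1`. -/
theorem massLam_le (M : ℕ) [NeZero M] (Lc : ℕ) :
    ((2 * (2 * (d + 1) * (Lc + 1) * M) + 1) ^ (d + 1) : ℕ) * ((2 * (2 * (d + 1) * (Lc + 1) * M) + 1) ^ (d + 1) : ℕ) *
        (2 * (ell (d + 1) Lc : ℝ) ^ 2 / (M : ℝ) ^ (2 * (d + 1))) ≤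
      ((4 * ((d : ℝ) + 1) * (Lc + 1) + 1) ^ (d + 1)) ^ 2 * (2 * (ell (d + 1) Lc : ℝ) ^ 2) := by
  have hM1 : (1 : ℝ) ≤ M := by exact_mod_cast Nat.one_le_iff_ne_zero.2 (NeZero.ne M)
  have hM : (0 : ℝ) < M := by linarith
  -- `(2R+1) ≤ (4(d+1)(Lc+1)+1)·M`
  have h1 : ((2 * (2 * (d + 1) * (Lc + 1) * M) + 1 : ℕ) : ℝ) ≤ (4 * ((d : ℝ) + 1) * (Lc + 1) + 1) * M := by
    push_cast
    nlinarith
  have h2 : (((2 * (2 * (d + 1) * (Lc + 1) * M) + 1) ^ (d + 1) : ℕ) : ℝ) ≤ ((4 * ((d : ℝ) + 1) * (Lc + 1) + 1) * M) ^ (d + 1) := by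
    push_cast
    exact pow_le_pow_left₀ (by positivity) (by push_cast at h1; linarith) _
  have hpos : (0 : ℝ) ≤ 2 * (ell (d + 1) Lc : ℝ) ^ 2 := by positivity
  calc _ ≤ ((4 * ((d : ℝ) + 1) * (Lc + 1) + 1) * M) ^ (d + 1) * ((4 * ((d : ℝ) + 1) * (Lc + 1) + 1) * M) ^ (d + 1) *
          (2 * (ell (d + 1) Lc : ℝ) ^ 2 / (M : ℝ) ^ (2 * (d + 1))) :=
        mul_le_mul_of_nonneg_right (mul_le_mul h2 h2 (Nat.cast_nonneg _) (by positivity)) (by positivity)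
    _ = ((4 * ((d : ℝ) + 1) * (Lc + 1) + 1) ^ (d + 1)) ^ 2 * (2 * (ell (d + 1) Lc : ℝ) ^ 2) := by
        rw [mul_pow]
        field_simp
        ring

end Mass

end Summit.QuantumFields.BalabanUV.Beta.GAN24.TaylorMassLam

end
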